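import Mathlib
import Literature.MathematicalPhysics.QuantumLattice.BdGBondHamiltonianFreeEnergyBounds
import Summits.HubbardSuperconductivity.HubbardSuperconductivity.Theorems.BalabanIRBirGappedPhaseReductionFermionWeight
import HarnessLib

/-!
# Route BalabanIR — cruxes 3/4 (`BirBdGPhaseCoercivity` ⇒ dictionary of `BirGappedPhaseReduction`, items stmt-HubbardSuperconductivity-2081/2082): crux 3 as typed, read on Fock space

Crux 3 `BirBdGPhaseCoercivity` is typed on first-quantised `2L² × 2L²` Bogoliubov–de Gennes matrices
`Hb(θ) = fromBlocks h D(θ) D(θ)ᴴ (-h)` over `TorusSite 2 L ⊕ TorusSite 2 L` and asserts the global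
lattice inequality `c₀ Σ_{⟨xy⟩}(1 - cos(θ_x - θ_y)) ≤ Σ_i|λ_i(Hb 0)| - Σ_i|λ_i(Hb θ)|`. Its ROLE
paragraph (route file) says what this is FOR: with Hölder it bounds the fermionic weight of a space-time
phase configuration. This file makes that reading a theorem about the tree's SECOND-QUANTISED objects:
transporting the `d+id` bond data along `FermionTorus.equivTorusSite` to the Jordan–Wigner site type
`FermionTorus 2 L` (hopping `τ = -adjacency`, pairing `Δ(θ) = -½ conj D(θ)`, so that the Nambu matrix
of `bdgBondHamiltonian τ Δ(θ) μ` IS `Hb(θ)` reindexed, `bdgNambuMatrix_transport_eq_reindex_fromBlocks`),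
the conclusion of crux 3 — whose `IsHermitian` provisos are DISCHARGED here (`isHermitian_fromBlocks_bdg`)
— yields, for the Fock-space BdG Hamiltonians `H_F(θ)` of the chiral `d+id` reference:

1. **phase rigidity of the quasi-free ground-state energy**:
   `E₀(H_F(θ)) - E₀(H_F(0)) ≥ (c₀/2) Σ_{⟨xy⟩}(1 - cos(θ_x - θ_y))` (`groundEnergy_bdgBondHamiltonian`:
   `E₀(H_F(θ)) = Σ_x(Re τ(x,x) - μ) - ½Σ_i|λ_i(Hb θ)|`, `= -μL² - ½Σ_i|λ_i(Hb θ)|` for `L ≥ 2`);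
2. **thermal slice bound**: `Tr e^{-βH_F(θ)} ≤ 4^{L²} e^{-βc₀S(θ)/2} Tr e^{-βH_F(0)}` (`β ≥ 0`);
3. **space-time fermionic weight bound** (`M = 2^{k+1}` Trotter slices of width `a ≥ 0`):
   `‖Tr ∏_τ e^{-aH_F(θ_τ)}‖ ≤ 4^{L²} e^{-(ac₀/2)Σ_τ S(θ_τ)} Tr e^{-MaH_F(0)}`
   (`norm_trace_prod_gibbs_bdg_le_of_coercive`, i.e. Hölder `…TraceHolder` + the BdG free-energy bounds).

The hypothesis is the BODY of `BirBdGPhaseCoercivity` verbatim (route rev 5), so that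
`fockCoercivity_of_birBdGPhaseCoercivity h` typechecks for `h : BalabanIR.BirBdGPhaseCoercivity` (checked
in a scratch file importing the route module; this module itself is `Theses`-free). No definition is
introduced; `--supports stmt-HubbardSuperconductivity-2082` (the coercivity dictionary, step (2)(C) of
the reduction) and, read backwards, the physical meaning of stmt-…-2081.

References: P. G. de Gennes (1966) Ch. 5 (BdG matrix, eq. (5-18)); V. Bach, E. H. Lieb,
J. P. Solovej, J. Stat. Phys. 76 (1994) 3 (quasi-free energy with pairing); B. Simon, *Trace Ideals*
(2005) Thm 2.8 (Hölder).
-/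

noncomputable section

namespace Summit.HubbardSuperconductivity.HubbardSuperconductivity.Theorems

open scoped BigOperators Topology Manifold Classical MeasureTheory ProbabilityTheory Matrix InnerProductSpace ComplexConjugate ContinuousMap
open Filter Set Function TopologicalSpace MeasureTheory
open Literature.MathematicalPhysics.QuantumLattice Literature.Probability.LatticeModels

/-! ### Symmetry of the torus shift relations -/

/-- `y = x ± a ↔ x = y ± a` in an additive commutative group. [folklore] -/
theorem eq_add_or_eq_add_neg_comm {G : Type*} [AddCommGroup G] (x y a : G) :
    (y = x + a ∨ y = x + -a) ↔ (x = y + a ∨ x = y + -a) := by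
  constructor
  · rintro (h | h)
    · right; rw [h]; abel
    · left; rw [h]; abel
  · rintro (h | h)
    · right; rw [h]; abel
    · left; rw [h]; abel

/-- `(-1, 0) = -(1, 0)` on the torus. [folklore] -/
theorem torusVec_neg_one_zero (L : ℕ) : (![-1, 0] : TorusSite 2 L) = -![1, 0] := by
  ext i; fin_cases i <;> simp

/-- `(0, -1) = -(0, 1)` on the torus. [folklore] -/
theorem torusVec_zero_neg_one (L : ℕ) : (![0, -1] : TorusSite 2 L) = -![0, 1] := by
  ext i; fin_cases i <;> simp

/-- `(-1, -1) = -(1, 1)` on the torus. [folklore] -/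
theorem torusVec_neg_one_neg_one (L : ℕ) : (![-1, -1] : TorusSite 2 L) = -![1, 1] := by
  ext i; fin_cases i <;> simp

/-- `(-1, 1) = -(1, -1)` on the torus. [folklore] -/
theorem torusVec_neg_one_one (L : ℕ) : (![-1, 1] : TorusSite 2 L) = -![1, -1] := by
  ext i; fin_cases i <;> simp

/-! ### Crux 3 read on Fock space -/

/-- **Crux 3 (`BirBdGPhaseCoercivity`) as typed ⇒ Fock-space phase rigidity and fermionic-weight
bounds for the chiral `d+id` BdG reference on the torus** (see the module docstring; the hypothesis
is the body of `BalabanIR.BirBdGPhaseCoercivity`, route rev 5, verbatim).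
[cite: Simon2005TraceIdeals, Theorem 2.8] -/
theorem fockCoercivity_of_birBdGPhaseCoercivity
    (hcrux3 : ∀ (μ Δ₁ Δ₂ : ℝ), μ ∈ Set.Ioo (-4:ℝ) 4 → Δ₁ ≠ 0 → Δ₂ ≠ 0 → ∃ c₀ : ℝ, 0 < c₀ ∧ ∃ L₀ : ℕ, ∀ (L : ℕ) [NeZero L], L₀ ≤ L → let nnx : Literature.Probability.LatticeModels.TorusSite 2 L → Literature.Probability.LatticeModels.TorusSite 2 L → Prop := fun x y => y = x + ![1, 0] ∨ y = x + ![-1, 0]; let nny : Literature.Probability.LatticeModels.TorusSite 2 L → Literature.Probability.LatticeModels.TorusSite 2 L → Prop := fun x y => y = x + ![0, 1] ∨ y = x + ![0, -1]; let dg1 : Literature.Probability.LatticeModels.TorusSite 2 L → Literature.Probability.LatticeModels.TorusSite 2 L → Prop := fun x y => y = x + ![1, 1] ∨ y = x + ![-1, -1]; let dg2 : Literature.Probability.LatticeModels.TorusSite 2 L → Literature.Probability.LatticeModels.TorusSite 2 L → Prop := fun x y => y = x + ![1, -1] ∨ y = x + ![-1, 1]; let h : Matrix (Literature.Probability.LatticeModels.TorusSite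 2 L) (Literature.Probability.LatticeModels.TorusSite 2 L) ℂ := fun x y => -(if nnx x y ∨ nny x y then (1 : ℂ) else 0) - (if x = y then (μ : ℂ) else 0); let D : (Literature.Probability.LatticeModels.TorusSite 2 L → ℝ) → Matrix (Literature.Probability.LatticeModels.TorusSite 2 L) (Literature.Probability.LatticeModels.TorusSite 2 L) ℂ := fun θ x y => ((Δ₁ : ℂ) * ((if nnx x y then (1 : ℂ) else 0) - (if nny x y then (1 : ℂ) else 0)) + Complex.I * (Δ₂ : ℂ) * ((if dg1 x y then (1 : ℂ) else 0) - (if dg2 x y then (1 : ℂ) else 0))) * (Complex.exp (Complex.I * (θ x : ℂ)) + Complex.exp (Complex.I * (θ y : ℂ))) / 2; let Hb : (Literature.Probability.LatticeModels.TorusSite 2 L → ℝ) → Matrix (Literature.Probability.LatticeModels.TorusSite 2 L ⊕ Literature.Probability.LatticeModels.TorusSite 2 L) (Literature.Probability.LatticeModels.TorusSite 2 L ⊕ Literature.Probability.LatticeModels.TorusSite 2 L) ℂ := fun θ => Matrix.fromBlocks h (D θ) (Matrix.conjTranspose (D θ)) (-h); ∀ θ : Literature.Probability.LatticeModels.TorusSite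 2 L → ℝ, ∀ (hθ : (Hb θ).IsHermitian) (h0 : (Hb (fun _ => 0)).IsHermitian), c₀ * ∑ x : Literature.Probability.LatticeModels.TorusSite 2 L, ∑ y : Literature.Probability.LatticeModels.TorusSite 2 L, (if nnx x y ∨ nny x y then (1 - Real.cos (θ x - θ y)) else 0) ≤ ∑ i, |h0.eigenvalues i| - ∑ i, |hθ.eigenvalues i|)
    (μ Δ₁ Δ₂ : ℝ) (hμ : μ ∈ Set.Ioo (-4:ℝ) 4) (hΔ₁ : Δ₁ ≠ 0) (hΔ₂ : Δ₂ ≠ 0) :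
    ∃ c₀ : ℝ, 0 < c₀ ∧ ∃ L₀ : ℕ, ∀ (L : ℕ) [NeZero L], L₀ ≤ L → letI : DecidableEq (Literature.MathematicalPhysics.QuantumLattice.FermionTorus 2 L) := LinearOrder.toDecidableEq; letI : DecidableEq (Literature.MathematicalPhysics.QuantumLattice.Orb (Literature.MathematicalPhysics.QuantumLattice.FermionTorus 2 L)) := LinearOrder.toDecidableEq; let nnx : Literature.Probability.LatticeModels.TorusSite 2 L → Literature.Probability.LatticeModels.TorusSite 2 L → Prop := fun x y => y = x + ![1, 0] ∨ y = x + ![-1, 0]; let nny : Literature.Probability.LatticeModels.TorusSite 2 L → Literature.Probability.LatticeModels.TorusSite 2 L → Prop := fun x y => y = x + ![0, 1] ∨ y = x + ![0, -1]; let dg1 : Literature.Probability.LatticeModels.TorusSite 2 L → Literature.Probability.LatticeModels.TorusSite 2 L → Prop := fun x y => y = x + ![1, 1] ∨ y = x + ![-1, -1]; let dg2 : Literature.Probability.LatticeModels.TorusSite 2 L → Literature.Probability.LatticeModels.TorusSite 2 L → Prop := fun x y => y = x + ![1, -1] ∨ y = x + ![-1, 1]; let D : (Literature.Probability.LatticeModels.TorusSite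 2 L → ℝ) → Matrix (Literature.Probability.LatticeModels.TorusSite 2 L) (Literature.Probability.LatticeModels.TorusSite 2 L) ℂ := fun θ x y => ((Δ₁ : ℂ) * ((if nnx x y then (1 : ℂ) else 0) - (if nny x y then (1 : ℂ) else 0)) + Complex.I * (Δ₂ : ℂ) * ((if dg1 x y then (1 : ℂ) else 0) - (if dg2 x y then (1 : ℂ) else 0))) * (Complex.exp (Complex.I * (θ x : ℂ)) + Complex.exp (Complex.I * (θ y : ℂ))) / 2; let e : Literature.MathematicalPhysics.QuantumLattice.FermionTorus 2 L ≃ Literature.Probability.LatticeModels.TorusSite 2 L := Literature.MathematicalPhysics.QuantumLattice.FermionTorus.equivTorusSite; let τ : Literature.MathematicalPhysics.QuantumLattice.FermionTorus 2 L → Literature.MathematicalPhysics.QuantumLattice.FermionTorus 2 L → ℂ := fun u v => -(if nnx (e u) (e v) ∨ nny (e u) (e v) then (1 : ℂ) else 0); let Δp : (Literature.Probability.LatticeModels.TorusSite 2 L → ℝ) → Literature.MathematicalPhysics.QuantumLattice.FermionTorus 2 L → Literature.MathematicalPhysics.QuantumLattice.FermionTorus 2 L → ℂ := fun θ u v =>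 -(1 / 2 : ℂ) * star (D θ (e u) (e v)); let HF : (Literature.Probability.LatticeModels.TorusSite 2 L → ℝ) → Matrix (Finset (Literature.MathematicalPhysics.QuantumLattice.Orb (Literature.MathematicalPhysics.QuantumLattice.FermionTorus 2 L))) (Finset (Literature.MathematicalPhysics.QuantumLattice.Orb (Literature.MathematicalPhysics.QuantumLattice.FermionTorus 2 L))) ℂ := fun θ => Literature.MathematicalPhysics.QuantumLattice.bdgBondHamiltonian τ (Δp θ) μ; let S : (Literature.Probability.LatticeModels.TorusSite 2 L → ℝ) → ℝ := fun θ => ∑ x : Literature.Probability.LatticeModels.TorusSite 2 L, ∑ y : Literature.Probability.LatticeModels.TorusSite 2 L, (if nnx x y ∨ nny x y then (1 - Real.cos (θ x - θ y)) else 0); (∀ θ : Literature.Probability.LatticeModels.TorusSite 2 L → ℝ, c₀ / 2 * S θ ≤ (HF θ).groundEnergy - (HF (fun _ => 0)).groundEnergy) ∧ (∀ θ : Literature.Probability.LatticeModels.TorusSite 2 L → ℝ, ∀ β : ℝ, 0 ≤ β → (Matrix.partitionFn β (HF θ)).re ≤ 4 ^ (L ^ 2) * Real.exp (-(β * c₀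 * S θ / 2)) * (Matrix.partitionFn β (HF (fun _ => 0))).re) ∧ (∀ (k : ℕ) (a : ℝ), 0 ≤ a → ∀ Θ : Fin (2 ^ (k + 1)) → Literature.Probability.LatticeModels.TorusSite 2 L → ℝ, ‖(List.ofFn fun i => NormedSpace.exp (-(a : ℂ) • HF (Θ i))).prod.trace‖ ≤ 4 ^ (L ^ 2) * Real.exp (-(a * c₀ / 2 * ∑ i, S (Θ i))) * (Matrix.partitionFn (((2 ^ (k + 1) : ℕ) : ℝ) * a) (HF (fun _ => 0))).re) := by
  obtain ⟨c₀, hc₀, L₀, hL⟩ := hcrux3 μ Δ₁ Δ₂ hμ hΔ₁ hΔ₂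
  refine ⟨c₀, hc₀, L₀, ?_⟩
  intro L _ hLL
  letI : DecidableEq (FermionTorus 2 L) := LinearOrder.toDecidableEq
  letI : DecidableEq (Orb (FermionTorus 2 L)) := LinearOrder.toDecidableEq
  intro nnx nny dg1 dg2 D e τ Δp HF S
  have key := hL L hLL
  -- symmetry of the bond relations and of the gap matrix
  have hnnx : ∀ x y, nnx x y ↔ nnx y x := by
    intro x y
    show (y = x + ![1, 0] ∨ y = x + ![-1, 0]) ↔ (x = y + ![1, 0] ∨ x = y + ![-1, 0])
    rw [torusVec_neg_one_zero]
    exact eq_add_or_eq_add_neg_comm x y _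
  have hnny : ∀ x y, nny x y ↔ nny y x := by
    intro x y
    show (y = x + ![0, 1] ∨ y = x + ![0, -1]) ↔ (x = y + ![0, 1] ∨ x = y + ![0, -1])
    rw [torusVec_zero_neg_one]
    exact eq_add_or_eq_add_neg_comm x y _
  have hdg1 : ∀ x y, dg1 x y ↔ dg1 y x := by
    intro x y
    show (y = x + ![1, 1] ∨ y = x + ![-1, -1]) ↔ (x = y + ![1, 1] ∨ x = y + ![-1, -1])
    rw [torusVec_neg_one_neg_one]
    exact eq_add_or_eq_add_neg_comm x y _
  have hdg2 : ∀ x y, dg2 x y ↔ dg2 y x := by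
    intro x y
    show (y = x + ![1, -1] ∨ y = x + ![-1, 1]) ↔ (x = y + ![1, -1] ∨ x = y + ![-1, 1])
    rw [torusVec_neg_one_one]
    exact eq_add_or_eq_add_neg_comm x y _
  have hDsym : ∀ θ x y, D θ x y = D θ y x := by
    intro θ x y
    show ((Δ₁ : ℂ) * ((if nnx x y then (1 : ℂ) else 0) - (if nny x y then (1 : ℂ) else 0)) +
        Complex.I * (Δ₂ : ℂ) * ((if dg1 x y then (1 : ℂ) else 0) - (if dg2 x y then (1 : ℂ) else 0))) *
        (Complex.exp (Complex.I * (θ x : ℂ)) + Complex.exp (Complex.I * (θ y : ℂ))) / 2 =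
      ((Δ₁ : ℂ) * ((if nnx y x then (1 : ℂ) else 0) - (if nny y x then (1 : ℂ) else 0)) +
        Complex.I * (Δ₂ : ℂ) * ((if dg1 y x then (1 : ℂ) else 0) - (if dg2 y x then (1 : ℂ) else 0))) *
        (Complex.exp (Complex.I * (θ y : ℂ)) + Complex.exp (Complex.I * (θ x : ℂ))) / 2
    simp only [hnnx x y, hnny x y, hdg1 x y, hdg2 x y,
      add_comm (Complex.exp (Complex.I * (θ x : ℂ))) (Complex.exp (Complex.I * (θ y : ℂ)))]
  -- the symmetric, real hopping matrix `τ₀ = -adjacency` on `TorusSite 2 L`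
  set τ₀ : TorusSite 2 L → TorusSite 2 L → ℂ := fun x y => -(if nnx x y ∨ nny x y then (1 : ℂ) else 0)
    with hτ₀def
  have hτ₀ : ∀ x y, τ₀ x y = τ₀ y x := by
    intro x y
    simp only [hτ₀def, hnnx x y, hnny x y]
  have hτ₀' : ∀ x y, star (τ₀ x y) = τ₀ y x := by
    intro x y
    rw [← hτ₀ x y]
    show star (-(if nnx x y ∨ nny x y then (1 : ℂ) else 0)) = -(if nnx x y ∨ nny x y then (1 : ℂ) else 0)
    split_ifs <;> simp
  -- crux 3's Hermitian provisos, discharged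
  have hHerm : ∀ θ' : TorusSite 2 L → ℝ,
      (Matrix.fromBlocks (fun x y => τ₀ x y - (if x = y then (μ : ℂ) else 0)) (D θ') (D θ')ᴴ
        (-(fun x y => τ₀ x y - (if x = y then (μ : ℂ) else 0)))).IsHermitian :=
    fun θ' => isHermitian_fromBlocks_bdg e τ₀ hτ₀ hτ₀' (D θ') (hDsym θ') μ
  -- the Fock-side hopping is Hermitian
  have hτF : ∀ u v : FermionTorus 2 L, star (τ u v) = τ v u := fun u v => hτ₀' (e u) (e v)
  -- transport of the spectral sums
  have hsum : ∀ θ' : TorusSite 2 L → ℝ,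
      ∑ i, |(hHerm θ').eigenvalues i| =
        ∑ j, |(isHermitian_bdgNambuMatrix hτF (Δp θ') μ).eigenvalues j| :=
    fun θ' => sum_comp_eigenvalues_fromBlocks_bdg_eq e τ₀ hτ₀ (D θ') (hDsym θ') μ (hHerm θ')
      (isHermitian_bdgNambuMatrix hτF (Δp θ') μ) (fun x => |x|)
  -- crux 3, instantiated, in Nambu terms
  have hcoer : ∀ θ' : TorusSite 2 L → ℝ, c₀ * S θ' ≤
      ∑ j, |(isHermitian_bdgNambuMatrix hτF (Δp (fun _ => 0)) μ).eigenvalues j| -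
        ∑ j, |(isHermitian_bdgNambuMatrix hτF (Δp θ') μ).eigenvalues j| := by
    intro θ'
    rw [← hsum θ', ← hsum (fun _ => 0)]
    exact key θ' (hHerm θ') (hHerm (fun _ => 0))
  have hcard : Fintype.card (FermionTorus 2 L) = L ^ 2 := by
    rw [Fintype.card_lex, Fintype.card_fun, Fintype.card_fin, Fintype.card_fin]
  refine ⟨?_, ?_, ?_⟩
  · -- 1. ground-state energies
    intro θ
    have hθ := hcoer θ
    show c₀ / 2 * S θ ≤ (bdgBondHamiltonian τ (Δp θ) μ).groundEnergy -
      (bdgBondHamiltonian τ (Δp (fun _ => 0)) μ).groundEnergy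
    rw [groundEnergy_bdgBondHamiltonian hτF (Δp θ) μ,
      groundEnergy_bdgBondHamiltonian hτF (Δp (fun _ => 0)) μ]
    linarith [hθ]
  · -- 2. thermal slice bound
    intro θ β hβ
    have h := re_partitionFn_bdg_le_of_coercive hτF (Δp θ) (Δp (fun _ => 0)) μ (hcoer θ) hβ
    rw [hcard] at h
    exact h
  · -- 3. space-time weight bound
    intro k a ha Θ
    have h := norm_trace_prod_gibbs_bdg_le_of_coercive hτF μ k ha (fun i => Δp (Θ i)) (Δp (fun _ => 0))
      (fun i => S (Θ i)) (fun i => hcoer (Θ i))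
    rw [hcard] at h
    exact h

end Summit.HubbardSuperconductivity.HubbardSuperconductivity.Theorems

end
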